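import Summits.Ventures.YMGap.RobustBall.CovarianceLipschitzS
import Summits.Ventures.YMGap.RobustBall.SecondSusceptibilityMajorantS
import HarnessLib

/-!
# Venture YMGap, track ROBUST-BALL (Y2) — TIER 2: THE THIRD CUMULANT IS LIPSCHITZ IN THE ACTION, UNIFORMLY ON THE WEIGHTED BALL
# (the `u₃` twin of `CovarianceLipschitzS`; input of the Hölder-½ modulus of the second derivative of the state map)

HONEST FRAMING. WHAT THIS IS: a venture file (cell `pub-ymgap`, track Y2 ROBUST-BALL, seat rb-p1, theorems only).  Member `W ∈ MemBallZdS a Λ_t t`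
inside the one-link pair door `ρ := 6(d−1)|β| e^{a} e^{t} √(cv) + e^{a/2} √c Λ_t < 1` (`t ≥ 0`), modification `V' ∈ MemBallZdS η Λ_η t` (continuous
link-summable terms of ANY strength and range; only the one-link oscillation load `η` enters), `μ` ANY DLR state of `W`, `μ'` ANY DLR state of
`W + V'`; three bounded measurable local Frobenius-Lipschitz observables `f, g, h` (supports `Δ_•`, vectors `δ_•`, `S_• := Σδ_•`);
`u₃^ν(f; g; h) := cov_ν(fg, h) − ν(f)cov_ν(g, h) − ν(g)cov_ν(f, h)`, `κ := min(η,4)/(1−ρ)`: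
* ★ `abs_threePoint_sub_threePoint_le_of_perturbation_S` — `|u₃^{μ'}(f; g; h) − u₃^{μ}(f; g; h)| ≤ 40 N√N κ S_f S_g S_h`.
  Proof: centre the three observables at the unit configuration (`u₃` is invariant under constant shifts of each slot; `|f − f(1)| ≤ 2√N S_f`), then
  `Δcov(fg, h)` by `CovarianceLipschitzS` for the product observable (Lipschitz vector `2√N(S_f δ_g𝟙_{Δ_g} + S_g δ_f𝟙_{Δ_f})`: `16 N√N κ S_fS_gS_h`), and
  `Δ(⟨f⟩cov(g, h))`, `Δ(⟨g⟩cov(f, h))` by state stability (`StateStabilityS`: `|Δ⟨f⟩| ≤ (√N/2) κ S_f`), the crude bound `|cov| ≤ 8N S_gS_h` and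
  `CovarianceLipschitzS` again (`12 N√N κ S_fS_gS_h` each);
* `su2_abs_threePoint_sub_threePoint_le_dim4` — `SU(2)`, `ℤ⁴`, hypothesis-free on `MemBallZdS a Λ t` (`6|β_W| e^{a} e^{t} + e^{a/2} √(2/3) Λ < 1`):
  Lipschitz cylinders, constant `80√2 κ (#Λ_F K_F)(#Λ_G K_G)(#Λ_H K_H)`.
READING: `Σ_{(X,Y)} u₃(F; V_X; V_Y)` is the second derivative of the state along the line `W + sV` (`StateSecondDerivativeS`); this file is the
per-term input of its HÖLDER-½ MODULUS in the base point (successor file `SecondSusceptibilityHoelderS`: interpolation with the tree decay of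
`ThreePointDecayS`, as `SusceptibilityHoelderS` interpolates `CovarianceLipschitzS` with the pair decay).
WHAT THIS IS NOT: a decay statement (no distance enters); one-sided Dobrushin-comparison constants at lattice strong coupling; nothing about the
continuum limit or a Clay-sense mass gap.
-/

noncomputable section

open MeasureTheory Function Finset ProbabilityTheory Real
open scoped NNReal
open Literature.Probability.LatticeModels
open Literature.Probability.LatticeModels.DobrushinMetric
open Literature.MathematicalPhysics.QuantumLattice
open Literature.MathematicalPhysics.QuantumFieldTheory hiding ZdEdge
open Summit.QuantumFields.BalabanUV.InfraRed.StrongCouplingPoincareDoorSUN (oneLinkPoincareSUN_two_sharp)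
open Summit.Ventures.YMGap.CouplingResponse (threePoint_swap threePoint_rotate)

namespace Summit.Ventures.YMGap.RobustBall

variable {d N : ℕ}

section SUN

variable {W V' : Potential (ZdEdge d) (Matrix.specialUnitaryGroup (Fin N) ℂ)}

/-- ★ **THE THIRD CUMULANT IS LIPSCHITZ IN THE ACTION, uniformly on the weighted ball.**  Member `W ∈ MemBallZdS a Λ_t t` (`ρ < 1`, `t ≥ 0`),
modification `V' ∈ MemBallZdS η Λ_η t`, `μ` ANY DLR state of `W`, `μ'` ANY DLR state of `W + V'`, `f, g, h` bounded measurable local Frobenius-Lipschitz: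
`|u₃^{μ'}(f; g; h) − u₃^{μ}(f; g; h)| ≤ 40 N√N · min(η,4)/(1−ρ) · (Σδ_f)(Σδ_g)(Σδ_h)`. -/
theorem abs_threePoint_sub_threePoint_le_of_perturbation_S (hd : 1 ≤ d) (hN : 1 ≤ N) {β b c v a Λt t : ℝ}
    (hc : 0 ≤ c) (hv : 0 ≤ v) (hb : |β| * (2 * ((d : ℝ) - 1)) ≤ b)
    (hP : ∀ B : Matrix (Fin N) (Fin N) ℂ, matrixOpNorm B ≤ b →
      ∀ (ψ : Matrix.specialUnitaryGroup (Fin N) ℂ → ℝ) (M : ℝ), 0 ≤ M →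
        (∀ x y, |ψ x - ψ y| ≤ M * suFrobDist x y) →
        Var[ψ; (haarProbability (Matrix.specialUnitaryGroup (Fin N) ℂ)).tilted
          fun g => (N : ℝ) * ((g : Matrix (Fin N) (Fin N) ℂ) * B).trace.re] ≤ c * M ^ 2)
    (hVB : ∀ B : Matrix (Fin N) (Fin N) ℂ, matrixOpNorm B ≤ b → ∀ Δ : Matrix (Fin N) (Fin N) ℂ,
      Var[fun g : Matrix.specialUnitaryGroup (Fin N) ℂ =>
          (N : ℝ) * ((g : Matrix (Fin N) (Fin N) ℂ) * Δ).trace.re;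
        (haarProbability (Matrix.specialUnitaryGroup (Fin N) ℂ)).tilted
          fun g => (N : ℝ) * ((g : Matrix (Fin N) (Fin N) ℂ) * B).trace.re] ≤ v * frobNorm Δ ^ 2)
    (ht : 0 ≤ t) (hρ : 6 * ((d : ℝ) - 1) * |β| * (exp a * exp t * Real.sqrt (c * v)) + exp (a / 2) * Real.sqrt c * Λt < 1)
    (hW : MemBallZdS a Λt t W) {η Λη : ℝ} (hV' : MemBallZdS η Λη t V')
    {μ μ' : Measure (LGConfig d (Matrix.specialUnitaryGroup (Fin N) ℂ))}
    (hμ : μ ∈ perturbedGibbsMeasuresS (d := d) (fundamentalRep (Fin N)) (N * β) W)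
    (hμ' : μ' ∈ perturbedGibbsMeasuresS (d := d) (fundamentalRep (Fin N)) (N * β) (W + V'))
    {f : LGConfig d (Matrix.specialUnitaryGroup (Fin N) ℂ) → ℝ} (hfm : Measurable f) {Δf : Finset (ZdEdge d)}
    (hfdep : DependsOn f (↑Δf : Set (ZdEdge d))) {Mf : ℝ} (hMf : ∀ σ, |f σ| ≤ Mf) {δf : ZdEdge d → ℝ} (hδf : IsLipBound suFrobDist f δf)
    {g : LGConfig d (Matrix.specialUnitaryGroup (Fin N) ℂ) → ℝ} (hgm : Measurable g) {Δg : Finset (ZdEdge d)}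
    (hgdep : DependsOn g (↑Δg : Set (ZdEdge d))) {Mg : ℝ} (hMg : ∀ σ, |g σ| ≤ Mg) {δg : ZdEdge d → ℝ} (hδg : IsLipBound suFrobDist g δg)
    {h : LGConfig d (Matrix.specialUnitaryGroup (Fin N) ℂ) → ℝ} (hhm : Measurable h) {Δh : Finset (ZdEdge d)}
    (hhdep : DependsOn h (↑Δh : Set (ZdEdge d))) {Mh : ℝ} (hMh : ∀ σ, |h σ| ≤ Mh) {δh : ZdEdge d → ℝ} (hδh : IsLipBound suFrobDist h δh) :
    |(cov[fun σ => f σ * g σ, h; μ'] - (∫ σ, f σ ∂μ') * cov[g, h; μ'] - (∫ σ, g σ ∂μ') * cov[f, h; μ']) -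
        (cov[fun σ => f σ * g σ, h; μ] - (∫ σ, f σ ∂μ) * cov[g, h; μ] - (∫ σ, g σ ∂μ) * cov[f, h; μ])| ≤
      40 * N * Real.sqrt N *
        (min η 4 / (1 - (6 * ((d : ℝ) - 1) * |β| * (exp a * exp t * Real.sqrt (c * v)) + exp (a / 2) * Real.sqrt c * Λt))) *
        (∑ y ∈ Δf, δf y) * (∑ y ∈ Δg, δg y) * (∑ y ∈ Δh, δh y) := by
  classical
  haveI : SecondCountableTopology (Matrix (Fin N) (Fin N) ℂ) :=
    inferInstanceAs (SecondCountableTopology (Fin N → Fin N → ℂ))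
  haveI : SecondCountableTopology (Matrix.specialUnitaryGroup (Fin N) ℂ) :=
    Topology.IsEmbedding.subtypeVal.secondCountableTopology
  have hμP : IsGibbsMeasure (perturbedYMS (d := d) (fundamentalRep (Fin N)) (N * β) W) μ := hμ
  have hμ'P : IsGibbsMeasure (perturbedYMS (d := d) (fundamentalRep (Fin N)) (N * β) (W + V')) μ' := hμ'
  haveI := hμP.isProbabilityMeasure
  haveI := hμ'P.isProbabilityMeasure
  obtain ⟨BW, hBW⟩ := hW.summable
  obtain ⟨osc, lip, ℓ, hosc, hlip, hoscs, hosca, hlips, hℓ, hℓs, hℓt⟩ := hW.loads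
  obtain ⟨BV, hBV⟩ := hV'.summable
  obtain ⟨oscV, lipV', ℓV, hoscV, -, hoscVs, hoscVa, -, -, -, -⟩ := hV'.loads
  obtain ⟨ρ, hρdef⟩ : ∃ ρ : ℝ, ρ = 6 * ((d : ℝ) - 1) * |β| * (exp a * exp t * Real.sqrt (c * v)) + exp (a / 2) * Real.sqrt c * Λt :=
    ⟨_, rfl⟩
  rw [← hρdef] at hρ ⊢
  obtain ⟨κ, hκ⟩ : ∃ x : ℝ, x = min η 4 / (1 - ρ) := ⟨_, rfl⟩
  rw [← hκ]
  have hκ0 : 0 ≤ κ := by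
    have h1ρ : 0 < 1 - ρ := sub_pos.2 hρ
    have hd0 : 0 < d := hd
    have h0 : (0 : ℝ) ≤ η := le_trans (tsum_nonneg fun X => by
      split_ifs
      · exact (hoscV X).nonneg _
      · exact le_rfl) (hoscVa (0, ⟨0, hd0⟩))
    rw [hκ]; exact div_nonneg (le_min h0 (by norm_num)) h1ρ.le
  -- state stability and covariance Lipschitz bounds, for bounded local Frobenius-Lipschitz observables
  have hstab : ∀ {k : LGConfig d (Matrix.specialUnitaryGroup (Fin N) ℂ) → ℝ}, Measurable k → ∀ {Δ : Finset (ZdEdge d)},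
      DependsOn k (↑Δ : Set (ZdEdge d)) → ∀ {M : ℝ}, (∀ σ, |k σ| ≤ M) → ∀ {δ : ZdEdge d → ℝ}, IsLipBound suFrobDist k δ →
      |(∫ σ, k σ ∂μ') - ∫ σ, k σ ∂μ| ≤ Real.sqrt N / 2 * κ * ∑ y ∈ Δ, δ y := by
    intro k hkm Δ hkdep M hM δ hδ
    have key := abs_integral_sub_integral_le_of_perturbation_S hd hN hc hv hb hP hVB hBW hW.continuous hW.dependsOn hosc hoscs
      hosca hlip hlips hℓ ht hℓs hℓt (hρdef ▸ hρ) hBV hV'.continuous hV'.dependsOn hoscV hoscVs (bV := fun _ => η) hoscVa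
      (fun _ => le_rfl) hμ hμ' hkm hkdep hM hδ
    rw [← hρdef, abs_sub_comm] at key
    calc _ ≤ _ := key
      _ = _ := by rw [hκ]; ring
  have hcovL : ∀ {k : LGConfig d (Matrix.specialUnitaryGroup (Fin N) ℂ) → ℝ}, Measurable k → ∀ {Δ : Finset (ZdEdge d)},
      DependsOn k (↑Δ : Set (ZdEdge d)) → ∀ {δ : ZdEdge d → ℝ}, IsLipBound suFrobDist k δ →
      ∀ {k' : LGConfig d (Matrix.specialUnitaryGroup (Fin N) ℂ) → ℝ}, Measurable k' → ∀ {Δ' : Finset (ZdEdge d)},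
      DependsOn k' (↑Δ' : Set (ZdEdge d)) → ∀ {δ' : ZdEdge d → ℝ}, IsLipBound suFrobDist k' δ' →
      |cov[k, k'; μ'] - cov[k, k'; μ]| ≤ 4 * N * κ * (∑ y ∈ Δ, δ y) * ∑ y ∈ Δ', δ' y := by
    intro k hkm Δ hkdep δ hδ k' hk'm Δ' hk'dep δ' hδ'
    have key := abs_cov_sub_cov_le_of_perturbation_S hd hN hc hv hb hP hVB ht (hρdef ▸ hρ) hW hV' hμ hμ' hkm hkdep hδ hk'm hk'dep hδ'
    rw [← hρdef, ← hκ] at key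
    exact key
  -- centring at the unit configuration
  have hN2 : (0 : ℝ) ≤ 2 * Real.sqrt N := by positivity
  have hcentre : ∀ {k : LGConfig d (Matrix.specialUnitaryGroup (Fin N) ℂ) → ℝ} {Δ : Finset (ZdEdge d)} {δ : ZdEdge d → ℝ},
      DependsOn k (↑Δ : Set (ZdEdge d)) → IsLipBound suFrobDist k δ →
      (DependsOn (fun σ => k σ - k 1) (↑Δ : Set (ZdEdge d))) ∧ IsLipBound suFrobDist (fun σ => k σ - k 1) δ ∧
        ∀ σ, |k σ - k 1| ≤ 2 * Real.sqrt N * ∑ y ∈ Δ, δ y := by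
    intro k Δ δ hdep hδ
    refine ⟨fun σ τ hστ => by simp only [hdep hστ], ⟨hδ.nonneg, fun y σ τ hστ => by
      simpa only [sub_sub_sub_cancel_right] using hδ.le y σ τ hστ⟩, fun σ => ?_⟩
    calc |k σ - k 1| ≤ ∑ y ∈ Δ, δ y * suFrobDist (σ y) ((1 : LGConfig d (Matrix.specialUnitaryGroup (Fin N) ℂ)) y) :=
          abs_sub_le_sum_of_dependsOn hdep hδ σ 1
      _ ≤ ∑ y ∈ Δ, δ y * (2 * Real.sqrt N) := sum_le_sum fun y _ => mul_le_mul_of_nonneg_left (suFrobDist_le _ _) (hδ.nonneg y)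
      _ = 2 * Real.sqrt N * ∑ y ∈ Δ, δ y := by rw [← sum_mul]; ring
  obtain ⟨Sf, hSf⟩ : ∃ S : ℝ, S = ∑ y ∈ Δf, δf y := ⟨_, rfl⟩
  obtain ⟨Sg, hSg⟩ : ∃ S : ℝ, S = ∑ y ∈ Δg, δg y := ⟨_, rfl⟩
  obtain ⟨Sh, hSh⟩ : ∃ S : ℝ, S = ∑ y ∈ Δh, δh y := ⟨_, rfl⟩
  have hSf0 : 0 ≤ Sf := hSf ▸ sum_nonneg fun y _ => hδf.nonneg y
  have hSg0 : 0 ≤ Sg := hSg ▸ sum_nonneg fun y _ => hδg.nonneg y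
  have hSh0 : 0 ≤ Sh := hSh ▸ sum_nonneg fun y _ => hδh.nonneg y
  rw [← hSf, ← hSg, ← hSh]
  obtain ⟨hf₁dep, hf₁lip, hMf₁⟩ := hcentre hfdep hδf
  obtain ⟨hg₁dep, hg₁lip, hMg₁⟩ := hcentre hgdep hδg
  obtain ⟨hh₁dep, hh₁lip, hMh₁⟩ := hcentre hhdep hδh
  rw [← hSf] at hMf₁; rw [← hSg] at hMg₁; rw [← hSh] at hMh₁
  have hf₁m : Measurable fun σ => f σ - f 1 := hfm.sub measurable_const
  have hg₁m : Measurable fun σ => g σ - g 1 := hgm.sub measurable_const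
  have hh₁m : Measurable fun σ => h σ - h 1 := hhm.sub measurable_const
  have hMf' : ∀ σ, |f σ - f 1| ≤ Mf + Mf := fun σ => (abs_sub _ _).trans (add_le_add (hMf σ) (hMf 1))
  have hMg' : ∀ σ, |g σ - g 1| ≤ Mg + Mg := fun σ => (abs_sub _ _).trans (add_le_add (hMg σ) (hMg 1))
  have hMh' : ∀ σ, |h σ - h 1| ≤ Mh + Mh := fun σ => (abs_sub _ _).trans (add_le_add (hMh σ) (hMh 1))
  -- `u₃` is invariant under constant shifts of each slot
  have e0 : ∀ (ν : Measure (LGConfig d (Matrix.specialUnitaryGroup (Fin N) ℂ))) [IsProbabilityMeasure ν],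
      cov[fun σ => f σ * g σ, h; ν] - (∫ σ, f σ ∂ν) * cov[g, h; ν] - (∫ σ, g σ ∂ν) * cov[f, h; ν] =
        cov[fun σ => (f σ - f 1) * (g σ - g 1), fun σ => h σ - h 1; ν] -
          (∫ σ, (f σ - f 1) ∂ν) * cov[fun σ => g σ - g 1, fun σ => h σ - h 1; ν] -
          (∫ σ, (g σ - g 1) ∂ν) * cov[fun σ => f σ - f 1, fun σ => h σ - h 1; ν] := by
    intro ν _
    calc cov[fun σ => f σ * g σ, h; ν] - (∫ σ, f σ ∂ν) * cov[g, h; ν] - (∫ σ, g σ ∂ν) * cov[f, h; ν]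
        = cov[fun σ => f σ * g σ, fun σ => h σ - h 1; ν] - (∫ σ, f σ ∂ν) * cov[g, fun σ => h σ - h 1; ν] -
            (∫ σ, g σ ∂ν) * cov[f, fun σ => h σ - h 1; ν] := (threePoint_sub_const_right hfm hgm hhm hMf hMg hMh (h 1)).symm
      _ = cov[fun σ => g σ * (h σ - h 1), f; ν] - (∫ σ, g σ ∂ν) * cov[fun σ => h σ - h 1, f; ν] -
            (∫ σ, (h σ - h 1) ∂ν) * cov[g, f; ν] := threePoint_rotate hfm hgm hh₁m hMf hMg hMh'
      _ = cov[fun σ => g σ * (h σ - h 1), fun σ => f σ - f 1; ν] - (∫ σ, g σ ∂ν) * cov[fun σ => h σ - h 1, fun σ => f σ - f 1; ν] -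
            (∫ σ, (h σ - h 1) ∂ν) * cov[g, fun σ => f σ - f 1; ν] := (threePoint_sub_const_right hgm hh₁m hfm hMg hMh' hMf (f 1)).symm
      _ = cov[fun σ => (h σ - h 1) * (f σ - f 1), g; ν] - (∫ σ, (h σ - h 1) ∂ν) * cov[fun σ => f σ - f 1, g; ν] -
            (∫ σ, (f σ - f 1) ∂ν) * cov[fun σ => h σ - h 1, g; ν] := threePoint_rotate hgm hh₁m hf₁m hMg hMh' hMf'
      _ = cov[fun σ => (h σ - h 1) * (f σ - f 1), fun σ => g σ - g 1; ν] -
            (∫ σ, (h σ - h 1) ∂ν) * cov[fun σ => f σ - f 1, fun σ => g σ - g 1; ν] -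
            (∫ σ, (f σ - f 1) ∂ν) * cov[fun σ => h σ - h 1, fun σ => g σ - g 1; ν] :=
          (threePoint_sub_const_right hh₁m hf₁m hgm hMh' hMf' hMg (g 1)).symm
      _ = _ := threePoint_rotate hh₁m hf₁m hg₁m hMh' hMf' hMg'
  rw [e0 μ', e0 μ]
  -- the product `f₁ g₁`: local on `Δf ∪ Δg`, Lipschitz vector of total mass `4√N S_f S_g`
  have hpm : Measurable fun σ => (f σ - f 1) * (g σ - g 1) := hf₁m.mul hg₁m
  have hpdep := dependsOn_mul_union' hf₁dep hg₁dep
  have hplip := isLipBound_mul_restrict (fun _ _ => suFrobDist_nonneg _ _) hf₁dep hg₁dep hMf₁ hMg₁ (mul_nonneg hN2 hSf0) (mul_nonneg hN2 hSg0)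
    hf₁lip hg₁lip
  -- the five ingredients
  have e1 := hcovL hpm hpdep hplip hh₁m hh₁dep hh₁lip
  rw [sum_union_mul_restrict, ← hSf, ← hSg, ← hSh] at e1
  have e2 := hcovL hg₁m hg₁dep hg₁lip hh₁m hh₁dep hh₁lip
  have e3 := hcovL hf₁m hf₁dep hf₁lip hh₁m hh₁dep hh₁lip
  rw [← hSg, ← hSh] at e2; rw [← hSf, ← hSh] at e3
  have e4 := hstab hf₁m hf₁dep hMf₁ hf₁lip
  have e5 := hstab hg₁m hg₁dep hMg₁ hg₁lip
  rw [← hSf] at e4; rw [← hSg] at e5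
  have c2 : |cov[fun σ => g σ - g 1, fun σ => h σ - h 1; μ']| ≤ 2 * (2 * Real.sqrt N * Sg) * (2 * Real.sqrt N * Sh) :=
    abs_covariance_le_two_mul hg₁m hMg₁ hh₁m hMh₁
  have c3 : |cov[fun σ => f σ - f 1, fun σ => h σ - h 1; μ']| ≤ 2 * (2 * Real.sqrt N * Sf) * (2 * Real.sqrt N * Sh) :=
    abs_covariance_le_two_mul hf₁m hMf₁ hh₁m hMh₁
  have a2 : |∫ σ, (f σ - f 1) ∂μ| ≤ 2 * Real.sqrt N * Sf := abs_integral_le_of_abs_le hMf₁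
  have a3 : |∫ σ, (g σ - g 1) ∂μ| ≤ 2 * Real.sqrt N * Sg := abs_integral_le_of_abs_le hMg₁
  have hNN : Real.sqrt N * Real.sqrt N = N := Real.mul_self_sqrt (Nat.cast_nonneg N)
  -- abbreviations
  obtain ⟨P', hP'⟩ : ∃ x : ℝ, x = cov[fun σ => (f σ - f 1) * (g σ - g 1), fun σ => h σ - h 1; μ'] := ⟨_, rfl⟩
  obtain ⟨P, hP0⟩ : ∃ x : ℝ, x = cov[fun σ => (f σ - f 1) * (g σ - g 1), fun σ => h σ - h 1; μ] := ⟨_, rfl⟩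
  obtain ⟨A', hA'⟩ : ∃ x : ℝ, x = ∫ σ, (f σ - f 1) ∂μ' := ⟨_, rfl⟩
  obtain ⟨A, hA⟩ : ∃ x : ℝ, x = ∫ σ, (f σ - f 1) ∂μ := ⟨_, rfl⟩
  obtain ⟨B', hB'⟩ : ∃ x : ℝ, x = ∫ σ, (g σ - g 1) ∂μ' := ⟨_, rfl⟩
  obtain ⟨B, hB⟩ : ∃ x : ℝ, x = ∫ σ, (g σ - g 1) ∂μ := ⟨_, rfl⟩
  obtain ⟨C', hC'⟩ : ∃ x : ℝ, x = cov[fun σ => g σ - g 1, fun σ => h σ - h 1; μ'] := ⟨_, rfl⟩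
  obtain ⟨C, hC⟩ : ∃ x : ℝ, x = cov[fun σ => g σ - g 1, fun σ => h σ - h 1; μ] := ⟨_, rfl⟩
  obtain ⟨D', hD'⟩ : ∃ x : ℝ, x = cov[fun σ => f σ - f 1, fun σ => h σ - h 1; μ'] := ⟨_, rfl⟩
  obtain ⟨D, hD⟩ : ∃ x : ℝ, x = cov[fun σ => f σ - f 1, fun σ => h σ - h 1; μ] := ⟨_, rfl⟩
  rw [← hP', ← hP0] at e1 ⊢; rw [← hC', ← hC] at e2 ⊢; rw [← hD', ← hD] at e3 ⊢; rw [← hA', ← hA] at e4 ⊢; rw [← hB', ← hB] at e5 ⊢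
  rw [← hC'] at c2; rw [← hD'] at c3; rw [← hA] at a2; rw [← hB] at a3
  have halg : P' - A' * C' - B' * D' - (P - A * C - B * D) =
      (P' - P) - ((A' - A) * C' + A * (C' - C)) - ((B' - B) * D' + B * (D' - D)) := by ring
  rw [halg]
  have t1 : |(A' - A) * C' + A * (C' - C)| ≤ Real.sqrt N / 2 * κ * Sf * (2 * (2 * Real.sqrt N * Sg) * (2 * Real.sqrt N * Sh)) +
      2 * Real.sqrt N * Sf * (4 * N * κ * Sg * Sh) :=
    (abs_add_le _ _).trans (by
      rw [abs_mul, abs_mul]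
      exact add_le_add (mul_le_mul e4 c2 (abs_nonneg _) (by positivity)) (mul_le_mul a2 e2 (abs_nonneg _) (by positivity)))
  have t2 : |(B' - B) * D' + B * (D' - D)| ≤ Real.sqrt N / 2 * κ * Sg * (2 * (2 * Real.sqrt N * Sf) * (2 * Real.sqrt N * Sh)) +
      2 * Real.sqrt N * Sg * (4 * N * κ * Sf * Sh) :=
    (abs_add_le _ _).trans (by
      rw [abs_mul, abs_mul]
      exact add_le_add (mul_le_mul e5 c3 (abs_nonneg _) (by positivity)) (mul_le_mul a3 e3 (abs_nonneg _) (by positivity)))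
  calc |(P' - P) - ((A' - A) * C' + A * (C' - C)) - ((B' - B) * D' + B * (D' - D))|
      ≤ |P' - P| + |(A' - A) * C' + A * (C' - C)| + |(B' - B) * D' + B * (D' - D)| := by
        exact (abs_sub _ _).trans (add_le_add (abs_sub _ _) le_rfl)
    _ ≤ 4 * N * κ * (2 * Real.sqrt N * Sf * Sg + 2 * Real.sqrt N * Sg * Sf) * Sh +
        (Real.sqrt N / 2 * κ * Sf * (2 * (2 * Real.sqrt N * Sg) * (2 * Real.sqrt N * Sh)) + 2 * Real.sqrt N * Sf * (4 * N * κ * Sg * Sh)) +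
        (Real.sqrt N / 2 * κ * Sg * (2 * (2 * Real.sqrt N * Sf) * (2 * Real.sqrt N * Sh)) + 2 * Real.sqrt N * Sg * (4 * N * κ * Sf * Sh)) :=
        add_le_add (add_le_add e1 t1) t2
    _ = 32 * N * Real.sqrt N * κ * Sf * Sg * Sh + 8 * (Real.sqrt N * Real.sqrt N) * Real.sqrt N * κ * Sf * Sg * Sh := by ring
    _ = 40 * N * Real.sqrt N * κ * Sf * Sg * Sh := by rw [hNN]; ring

end SUN

/-! ### `SU(2)`, `ℤ⁴`, hypothesis-free -/

/-- **`SU(2)`, `ℤ⁴` — THE THIRD CUMULANT IS LIPSCHITZ IN THE ACTION, uniformly on `MemBallZdS a Λ t`.**  `0 ≤ t`,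
`6|β_W| e^{a} e^{t} + e^{a/2} √(2/3) Λ < 1` ⇒ for every member `W` (bare coupling `β_W/2`), every modification `V' ∈ MemBallZdS η Λ_η t`, every DLR `μ` of
`W`, EVERY DLR `μ'` of `W + V'` and Lipschitz cylinders `F, G, H` (bounds `M_•`):
`|u₃^{μ'}(F; G; H) − u₃^{μ}(F; G; H)| ≤ 80√2 · min(η,4)/(1−ρ) · (#Λ_F K_F)(#Λ_G K_G)(#Λ_H K_H)`, `ρ = 6|β_W| e^{a} e^{t} + e^{a/2} √(2/3) Λ`. -/
theorem su2_abs_threePoint_sub_threePoint_le_dim4 {βW a Λ t η Λη : ℝ} (ht : 0 ≤ t)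
    (hρ : 6 * |βW| * (exp a * exp t) + exp (a / 2) * Real.sqrt (2 / 3) * Λ < 1)
    {W V' : Potential (ZdEdge 4) (Matrix.specialUnitaryGroup (Fin 2) ℂ)} (hW : MemBallZdS a Λ t W) (hV' : MemBallZdS η Λη t V')
    {μ μ' : Measure (LGConfig 4 (Matrix.specialUnitaryGroup (Fin 2) ℂ))}
    (hμ : μ ∈ perturbedGibbsMeasuresS (d := 4) (fundamentalRep (Fin 2)) (2 * (βW / 4)) W)
    (hμ' : μ' ∈ perturbedGibbsMeasuresS (d := 4) (fundamentalRep (Fin 2)) (2 * (βW / 4)) (W + V'))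
    {F : LGConfig 4 (Matrix.specialUnitaryGroup (Fin 2) ℂ) → ℝ} {ΛF : Finset (ZdEdge 4)} {KF : ℝ≥0}
    (hF : IsLipschitzCylinder (fundamentalRep (Fin 2)) F ΛF KF) {MF : ℝ} (hMF : ∀ σ, |F σ| ≤ MF)
    {G : LGConfig 4 (Matrix.specialUnitaryGroup (Fin 2) ℂ) → ℝ} {ΛG : Finset (ZdEdge 4)} {KG : ℝ≥0}
    (hG : IsLipschitzCylinder (fundamentalRep (Fin 2)) G ΛG KG) {MG : ℝ} (hMG : ∀ σ, |G σ| ≤ MG)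
    {H : LGConfig 4 (Matrix.specialUnitaryGroup (Fin 2) ℂ) → ℝ} {ΛH : Finset (ZdEdge 4)} {KH : ℝ≥0}
    (hH : IsLipschitzCylinder (fundamentalRep (Fin 2)) H ΛH KH) {MH : ℝ} (hMH : ∀ σ, |H σ| ≤ MH) :
    |(cov[fun σ => F σ * G σ, H; μ'] - (∫ σ, F σ ∂μ') * cov[G, H; μ'] - (∫ σ, G σ ∂μ') * cov[F, H; μ']) -
        (cov[fun σ => F σ * G σ, H; μ] - (∫ σ, F σ ∂μ) * cov[G, H; μ] - (∫ σ, G σ ∂μ) * cov[F, H; μ])| ≤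
      80 * Real.sqrt 2 * (min η 4 / (1 - (6 * |βW| * (exp a * exp t) + exp (a / 2) * Real.sqrt (2 / 3) * Λ))) *
        (ΛF.card * KF) * (ΛG.card * KG) * (ΛH.card * KH) := by
  classical
  have hc : (0 : ℝ) ≤ 2 / 3 := by norm_num
  have hP : ∀ B : Matrix (Fin 2) (Fin 2) ℂ, matrixOpNorm B ≤ |βW / 4| * (2 * (((4 : ℕ) : ℝ) - 1)) →
      ∀ (ψ : Matrix.specialUnitaryGroup (Fin 2) ℂ → ℝ) (M : ℝ), 0 ≤ M →
        (∀ x y, |ψ x - ψ y| ≤ M * suFrobDist x y) →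
        Var[ψ; (haarProbability (Matrix.specialUnitaryGroup (Fin 2) ℂ)).tilted
          fun g => ((2 : ℕ) : ℝ) * ((g : Matrix (Fin 2) (Fin 2) ℂ) * B).trace.re] ≤ 2 / 3 * M ^ 2 :=
    fun B hB ψ M hM hψ => oneLinkPoincareSUN_two_sharp _ B hB ψ M hM hψ
  have hVB := linVariance_of_poincare (N := 2) hP
  have hv : (0 : ℝ) ≤ 2 / 3 * ((2 : ℕ) : ℝ) ^ 2 := by norm_num
  have hsq : Real.sqrt (2 / 3 * (2 / 3 * ((2 : ℕ) : ℝ) ^ 2)) = 4 / 3 := by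
    rw [show (2 / 3 * (2 / 3 * ((2 : ℕ) : ℝ) ^ 2) : ℝ) = (4 / 3) ^ 2 by norm_num, Real.sqrt_sq (by norm_num)]
  have hρeq : 6 * (((4 : ℕ) : ℝ) - 1) * |βW / 4| * (exp a * exp t * Real.sqrt (2 / 3 * (2 / 3 * ((2 : ℕ) : ℝ) ^ 2))) +
      exp (a / 2) * Real.sqrt (2 / 3) * Λ = 6 * |βW| * (exp a * exp t) + exp (a / 2) * Real.sqrt (2 / 3) * Λ := by
    rw [hsq, abs_div, abs_of_pos (by norm_num : (0 : ℝ) < 4)]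
    norm_num; ring
  have hρ' : 6 * (((4 : ℕ) : ℝ) - 1) * |βW / 4| * (exp a * exp t * Real.sqrt (2 / 3 * (2 / 3 * ((2 : ℕ) : ℝ) ^ 2))) +
      exp (a / 2) * Real.sqrt (2 / 3) * Λ < 1 := by rw [hρeq]; exact hρ
  have hμ₁ : μ ∈ perturbedGibbsMeasuresS (d := 4) (fundamentalRep (Fin 2)) ((2 : ℕ) * (βW / 4)) W := by simpa using hμ
  have hμ₁' : μ' ∈ perturbedGibbsMeasuresS (d := 4) (fundamentalRep (Fin 2)) ((2 : ℕ) * (βW / 4)) (W + V') := by simpa using hμ'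
  have hA : ∀ a b : Matrix.specialUnitaryGroup (Fin 2) ℂ, dist (suEntries a) (suEntries b) ≤ 1 * suFrobDist a b :=
    fun a b => by rw [one_mul]; exact dist_suEntries_le_suFrobDist a b
  have key := abs_threePoint_sub_threePoint_le_of_perturbation_S (N := 2) (d := 4) (by norm_num) (by norm_num) hc hv le_rfl hP hVB ht hρ'
    hW hV' hμ₁ hμ₁' hF.measurable hF.dependsOn hMF (hF.isLipBound zero_le_one hA) hG.measurable hG.dependsOn hMG (hG.isLipBound zero_le_one hA)
    hH.measurable hH.dependsOn hMH (hH.isLipBound zero_le_one hA)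
  rw [hρeq] at key
  refine key.trans (le_of_eq ?_)
  have hsum : ∀ (Λ₀ : Finset (ZdEdge 4)) (K : ℝ≥0), ∑ y ∈ Λ₀, (if y ∈ Λ₀ then (1 : ℝ) * (K : ℝ) else 0) = Λ₀.card * K := fun Λ₀ K => by
    rw [Finset.sum_congr rfl fun y hy => by rw [if_pos hy, one_mul], Finset.sum_const, nsmul_eq_mul]
  have h2 : Real.sqrt ((2 : ℕ) : ℝ) = Real.sqrt 2 := by norm_num
  rw [hsum, hsum, hsum, h2]
  norm_num

end Summit.Ventures.YMGap.RobustBall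

end
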